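import Mathlib
import Summits.ABC.ABC.Theses.ThreeSlotCyclotomicDescent

/-!
# Glue of the zoo split on `route-ABC-ThreeSlotCyclotomicDescent`

Closes the glue item `CyclotomicZooABC_of_split` (stmt-ABC-24027):
`ZooSorting → SolvedZooABC → ZooWallsABC → CyclotomicZooABC`.

The proof is the case split itself: `ZooSorting` sorts every non-rigid abc triple with
ω(abc) ≤ 3 into `c ≤ 5·rad` (whence `c < 6·rad^{1+ε}` because `rad ≥ 1`), a solved family
(constant `C_L` from `SolvedZooABC`) or a wall (constant `C_W` from `ZooWallsABC`); take
`C = max 6 (max C_L C_W)`.  No number theory is used here.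
-/

namespace Summit.ABC.ABC.Theorems.ThreeSlotZooSplitGlue

open Summit.ABC.ABC.Theses.ThreeSlotCyclotomicDescent

/-- The glue item of the split of `CyclotomicZooABC`, by the three-way case split. -/
theorem cyclotomicZooABC_of_split : CyclotomicZooABC_of_split := by
  intro hS hL hW ε hε
  obtain ⟨C₁, -, h₁⟩ := hL ε hε
  obtain ⟨C₂, -, h₂⟩ := hW ε hε
  refine ⟨max 6 (max C₁ C₂), lt_max_of_lt_left (by norm_num), ?_⟩
  intro a b c ht hω hnr
  have hradpos : 0 < Literature.NumberTheory.DiophantineGeometry.rad a b c := Nat.radical_pos _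
  set R : ℝ := ((Literature.NumberTheory.DiophantineGeometry.rad a b c : ℕ) : ℝ) with hR
  have hR1 : (1 : ℝ) ≤ R := by
    rw [hR]; exact_mod_cast hradpos
  have hRpow : R ≤ R ^ (1 + ε) := by
    calc R = R ^ (1 : ℝ) := (Real.rpow_one R).symm
      _ ≤ R ^ (1 + ε) := Real.rpow_le_rpow_of_exponent_le hR1 (by linarith)
  have hRpow_pos : 0 < R ^ (1 + ε) := Real.rpow_pos_of_pos (by linarith) _
  rcases hS a b c ht hω hnr with h5 | hl | hw
  · have h5' : (c : ℝ) ≤ 5 * R := by rw [hR]; exact_mod_cast h5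
    calc (c : ℝ) ≤ 5 * R := h5'
      _ ≤ 5 * R ^ (1 + ε) := by nlinarith
      _ < 6 * R ^ (1 + ε) := by nlinarith
      _ ≤ max 6 (max C₁ C₂) * R ^ (1 + ε) :=
          mul_le_mul_of_nonneg_right (le_max_left _ _) hRpow_pos.le
  · calc (c : ℝ) < C₁ * R ^ (1 + ε) := h₁ a b c ht hl
      _ ≤ max 6 (max C₁ C₂) * R ^ (1 + ε) :=
          mul_le_mul_of_nonneg_right ((le_max_left _ _).trans (le_max_right _ _)) hRpow_pos.le
  · calc (c : ℝ) < C₂ * R ^ (1 + ε) := h₂ a b c ht hw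
      _ ≤ max 6 (max C₁ C₂) * R ^ (1 + ε) :=
          mul_le_mul_of_nonneg_right ((le_max_right _ _).trans (le_max_right _ _)) hRpow_pos.le

end Summit.ABC.ABC.Theorems.ThreeSlotZooSplitGlue
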